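/-
Copyright (c) 2026 the pub-hodgecm-mathlib formalisation cell (harness21).  Prover seat hodgecm-mathlib-F0P3a-p01 (g15), 2026-09-01.  Road «S3-ram» (LEAD F0P3a-plan (g12)
T11-61; owner F0P3a-p06 (g15)): organ «(O2″)-deep SOCKET» — the place-generic `t`-removal for LEFT-LEVEL-INVARIANT pieces at a LEVEL-DEEP split torus.
-/
import Literature.NumberTheory.Automorphic.TorusTwoDeepLevelTwoStrata     -- ★ p846625: §1 level-two matrix kit `inv_smul_coe_inv_mul_mul_coe_sub_one`, `valBound_coe_and_inv_of_mem_glInt`; ⊇ ★ p846544 socket `classOrbitalIntegral_eq_mul_of_level_frame_of_integral_eq`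
import HarnessLib

/-!
# The canonical orbital integral of a LEFT-LEVEL-INVARIANT `K`-class piece at a LEVEL-DEEP split-torus class: the `t`-removal socket
# (Rogawski (1990) §4.9 pp. 54–56; Kottwitz (1986) §3)

Topic `NumberTheory/Automorphic`; namespace `Literature.NumberTheory.Automorphic.UnitaryGroup`.  KERNEL mathematics only: theorems, no definition, no named fact,
no instance, no notation, no `sorry`.  Cell `pub/hodgecm-mathlib`, crux H413 = `stmt-HodgeConjecture-24833`; road «S3-ram» (Literature seeding; LEAD F0P3a-plan (g12)
T11-61, owner F0P3a-p06 (g15)), organ **«(O2″)-deep SOCKET»** (seat F0P3a-p01 (g15)): what lifts the (e3) Levi row (★ core p846879) from the residual-rank-constant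
sub-class (★ p846896 over ★ p846888) to the FULL piece class of END's `stub_levelOneRowsRam` (fold v6 :118: pieces left-invariant under the `v`-level-1 congruence set
`K(ϖ_v)`), WITHOUT any strata: the `𝔭`-layer enters only through the scalar `∫_N g(ψ⁻¹ n) dμ_N`.  PLACE-GENERIC (binds `hw` only).  HONEST LABEL: HC_CM is proved
only modulo the cell's 2 remaining named inputs (hLiu418 24832, h413 24833) until rung 0 closes; «S3-ram» has no books consequence; this file is unconditional and
discharges nothing by itself.

THE MATHEMATICS.  Setting of ★ `classOrbitalIntegral_eq_mul_of_level_frame_of_integral_eq` (p846544 §2): a level-preserving frame `ψ : U(H′)(L⁺_v) ≃ₜ* U(Φ₃)(L⁺_v)`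
with matrix reading `(ψ x)_w = T x_w T⁻¹`, `T ∈ GL₃(𝒪_w)`; `m_G` canonical; `t = diag(d) ∈ T` regular with `ψ γ₀ = t`; `μ_N` any Haar measure of `N`; `g` Borel and
`Ad K′`-invariant.  NEW HYPOTHESES: `g` is LEFT-INVARIANT under the congruence set «`u_w ≡ 1 (mod ϖ_v)`» (END's `hg1` token VERBATIM) and `t` is LEVEL-DEEP,
`|d_{i,w} − 1|_w ≤ |ϖ_v|_w`.  Then `(ψ⁻¹t)_w = T⁻¹ diag(d_w) T ≡ 1 (mod ϖ_v)` (★ `inv_smul_coe_inv_mul_mul_coe_sub_one`, `ValBound` kit), so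
`g(ψ⁻¹(t n)) = g(ψ⁻¹t · ψ⁻¹n) = g(ψ⁻¹ n)` for every `n ∈ N`, and the socket gives
**`classOrbitalIntegral m_G g ⟦γ₀⟧ = ν_G(K′) · J₃(t) · X` whenever `∫_N g(ψ⁻¹ n) dμ_N = μ_N(N ∩ K₃) · X`** — the `G`-side value is a `t`-INDEPENDENT functional of `g`.
At a tame-ramified `w` (`|ϖ_v|_w = q_w⁻²`) level-deep = 2-deep (★ (O1″) `exists_nhds_one_forall_levi_twoDeep` supplies it near `1`); at an inert `w` it is 1-deep.

## References
* [Rogawski1990] J. D. Rogawski, *Automorphic Representations of Unitary Groups in Three Variables*, Ann. of Math. Stud. 123 (1990), §4.9 pp. 54–56, Prop. 4.9.1; §4.3 (4.3.1) p. 43.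
* [Kottwitz1986] R. E. Kottwitz, *Base change for unit elements of Hecke algebras*, Compositio Math. 60 (1986), §3 (congruence filtration).
* [DeitmarEchterhoff2014] A. Deitmar, S. Echterhoff, *Principles of Harmonic Analysis*, 2nd ed. (2014), Thm. 1.5.3.
-/

set_option autoImplicit false

noncomputable section

open MeasureTheory Measure Set Filter Topology NumberField IsDedekindDomain Matrix ValuativeRel
open scoped ENNReal NNReal Matrix MatrixGroups ValuativeRel WithZero

namespace Literature.NumberTheory.Automorphic.UnitaryGroup

open Literature.NumberTheory.Rogawski1990 (IsRegularElt)
open Literature.NumberTheory.Automorphic Literature.NumberTheory.Automorphic.IntegralReduction Literature.NumberTheory.GaloisRepresentations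

variable (L : Type) [Field L] [NumberField L] [IsCMField L] {v : HeightOneSpectrum (𝓞 ↥(maximalRealSubfield L))}
  (w : PlacesOver L v) (hw : IsCMField.complexConj L • w.1 = w.1)

/-! ## §1 `(ψ⁻¹ t)_w ≡ 1 (mod ϖ_v)` for a level-deep torus element through an integral frame -/

omit [IsCMField L] in
/-- `ϖ⁻¹ • (diag(d) − 1)` is integral when `|d_i − 1| ≤ |ϖ|`, `ϖ ≠ 0`. [cite: Kottwitz1986, §3] -/
theorem valBound_inv_smul_diagonal_sub_one {ϖ : w.1.adicCompletion L} (hϖ : ϖ ≠ 0) (d : Fin 3 → w.1.adicCompletion L)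
    (hd : ∀ i, Valued.v (d i - 1) ≤ Valued.v ϖ) :
    ValBound 1 (ϖ⁻¹ • (Matrix.diagonal d - 1)) := by
  intro i j
  rw [Matrix.smul_apply, Matrix.sub_apply, smul_eq_mul, ← v_le_one_iff_valuation_le_one]
  by_cases hij : i = j
  · subst hij
    rw [Matrix.diagonal_apply_eq, Matrix.one_apply_eq, map_mul, map_inv₀]
    have hϖv : Valued.v ϖ ≠ 0 := (Valuation.ne_zero_iff _).2 hϖ
    calc (Valued.v ϖ)⁻¹ * Valued.v (d i - 1) ≤ (Valued.v ϖ)⁻¹ * Valued.v ϖ := by gcongr; exact hd i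
      _ = 1 := inv_mul_cancel₀ hϖv
  · rw [Matrix.diagonal_apply_ne _ hij, Matrix.one_apply_ne hij, sub_zero, mul_zero, map_zero]
    exact zero_le_one

set_option maxHeartbeats 800000 in
-- instance-term unification on the CM local carriers (as in ★ p846544)
include hw in
/-- **`(ψ⁻¹ t)_w ≡ 1 (mod ϖ_v)`**: through a frame with `(ψ x)_w = T x_w T⁻¹`, `T ∈ GL₃(𝒪_w)`, a torus element `t = diag(d)` with `|d_{i,w} − 1|_w ≤ |ϖ_v|_w` pulls back to an
element of the congruence set «`u_w ≡ 1 (mod ϖ_v)`» of `U(H′)(L⁺_v)` (END's `hg1` token). [cite: Kottwitz1986, §3] [cite: Rogawski1990, §4.9 p. 54] -/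
theorem valued_symm_torus_sub_one_le (H' : Matrix (Fin 3) (Fin 3) L)
    (ψ : (cmDatum L 3 H').Local v ≃ₜ* ↥(unitaryGroupOfForm (conjLocal L (IsCMField.complexConj L) v) (cmLocalForm L 3 v)))
    (T : GL (Fin 3) (w.1.adicCompletion L)) (hT : T ∈ glInt 3 (w.1.adicCompletion L))
    (hψT : ∀ g : (cmDatum L 3 H').Local v, localGLPiEquiv L 3 v
        (((ψ g : ↥(unitaryGroupOfForm (conjLocal L (IsCMField.complexConj L) v) (cmLocalForm L 3 v))) : GL (Fin 3) (LocalRing L v))) w =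
      T * localGLPiEquiv L 3 v (g.val : GL (Fin 3) (LocalRing L v)) w * T⁻¹)
    (t : ↥(torusU (conjLocal L (IsCMField.complexConj L) v) (cmLocalForm L 3 v))) {d : Fin 3 → (LocalRing L v)ˣ}
    (hd : glDiagonal 3 (LocalRing L v) d =
      ((t : ↥(unitaryGroupOfForm (conjLocal L (IsCMField.complexConj L) v) (cmLocalForm L 3 v))) : GL (Fin 3) (LocalRing L v)))
    (htd : ∀ i : Fin 3, Valued.v ((((d i : (LocalRing L v)ˣ) : LocalRing L v) w) - 1) ≤
      Valued.v (toPlace v w (HeckeCharacter.uniformizer ↥(maximalRealSubfield L) v : v.adicCompletion ↥(maximalRealSubfield L)))) :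
    ∀ a b, Valued.v (((toPlace v w (HeckeCharacter.uniformizer ↥(maximalRealSubfield L) v : v.adicCompletion ↥(maximalRealSubfield L))) ^ 1)⁻¹ *
        ((((localNonsplitEquiv (IsCMField.complexConj L) H' (IsCMField.complexConj_ne_one L) w hw
            (ψ.symm (t : ↥(unitaryGroupOfForm (conjLocal L (IsCMField.complexConj L) v) (cmLocalForm L 3 v)))) :
            ↥(unitaryGroupOfForm (galAdicCompletionMap (L := L) (IsCMField.complexConj L) hw) (placeForm H' w.1))) : GL (Fin 3) (w.1.adicCompletion L)) :
              Matrix (Fin 3) (Fin 3) (w.1.adicCompletion L)) a b - (1 : Matrix (Fin 3) (Fin 3) (w.1.adicCompletion L)) a b)) ≤ 1 := by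
  have hcne := IsCMField.complexConj_ne_one L
  have hϖ0 : (toPlace v w (HeckeCharacter.uniformizer ↥(maximalRealSubfield L) v : v.adicCompletion ↥(maximalRealSubfield L))) ≠ 0 :=
    (map_ne_zero (toPlace v w)).2 (Units.ne_zero _)
  -- the `w`-matrix of `ψ⁻¹ t` is `T⁻¹ · diag(d_w) · T`
  have hGL : ((localNonsplitEquiv (IsCMField.complexConj L) H' hcne w hw
      (ψ.symm (t : ↥(unitaryGroupOfForm (conjLocal L (IsCMField.complexConj L) v) (cmLocalForm L 3 v)))) :
        ↥(unitaryGroupOfForm (galAdicCompletionMap (L := L) (IsCMField.complexConj L) hw) (placeForm H' w.1))) : GL (Fin 3) (w.1.adicCompletion L)) =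
      T⁻¹ * ((localNonsplitEquiv (IsCMField.complexConj L) (Matrix.of fun i j : Fin 3 => if i.val + j.val + 1 = 3 then (1 : L) else 0) hcne w hw
        (t : ↥(unitaryGroupOfForm (conjLocal L (IsCMField.complexConj L) v) (cmLocalForm L 3 v))) :
          ↥(unitaryGroupOfForm (galAdicCompletionMap (L := L) (IsCMField.complexConj L) hw)
            (placeForm (Matrix.of fun i j : Fin 3 => if i.val + j.val + 1 = 3 then (1 : L) else 0) w.1))) : GL (Fin 3) (w.1.adicCompletion L)) * T := by
    have h := hψT (ψ.symm (t : ↥(unitaryGroupOfForm (conjLocal L (IsCMField.complexConj L) v) (cmLocalForm L 3 v))))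
    rw [ContinuousMulEquiv.apply_symm_apply] at h
    change localGLPiEquiv L 3 v _ w = T⁻¹ * localGLPiEquiv L 3 v _ w * T
    rw [h]; group
  have hmat : (((localNonsplitEquiv (IsCMField.complexConj L) (Matrix.of fun i j : Fin 3 => if i.val + j.val + 1 = 3 then (1 : L) else 0) hcne w hw
        (t : ↥(unitaryGroupOfForm (conjLocal L (IsCMField.complexConj L) v) (cmLocalForm L 3 v))) :
          ↥(unitaryGroupOfForm (galAdicCompletionMap (L := L) (IsCMField.complexConj L) hw)
            (placeForm (Matrix.of fun i j : Fin 3 => if i.val + j.val + 1 = 3 then (1 : L) else 0) w.1))) : GL (Fin 3) (w.1.adicCompletion L)) :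
        Matrix (Fin 3) (Fin 3) (w.1.adicCompletion L)) = Matrix.diagonal fun i => ((d i : (LocalRing L v)ˣ) : LocalRing L v) w := by
    rw [coe_coe_localNonsplitEquiv_apply, ← hd, coe_glDiagonal,
      Matrix.diagonal_map (RingHom.map_zero (Pi.evalRingHom (fun w' : PlacesOver L v => w'.1.adicCompletion L) w))]
    rfl
  -- `ϖ⁻¹ • (T⁻¹ D T − 1) = T⁻¹ (ϖ⁻¹ • (D − 1)) T` is integral
  have hVB : ValBound 1 ((toPlace v w (HeckeCharacter.uniformizer ↥(maximalRealSubfield L) v : v.adicCompletion ↥(maximalRealSubfield L)))⁻¹ •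
      (((T⁻¹ : GL (Fin 3) (w.1.adicCompletion L)) : Matrix (Fin 3) (Fin 3) (w.1.adicCompletion L)) *
        (Matrix.diagonal fun i => ((d i : (LocalRing L v)ˣ) : LocalRing L v) w) * (T : Matrix (Fin 3) (Fin 3) (w.1.adicCompletion L)) - 1)) := by
    rw [inv_smul_coe_inv_mul_mul_coe_sub_one]
    obtain ⟨h1, h2⟩ := valBound_coe_and_inv_of_mem_glInt L w hT
    have h := (h2.mul (valBound_inv_smul_diagonal_sub_one L w hϖ0 _ htd)).mul h1
    rwa [one_mul, one_mul] at h
  intro a b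
  have hab := hVB a b
  rw [← v_le_one_iff_valuation_le_one, Matrix.smul_apply, smul_eq_mul, Matrix.sub_apply] at hab
  rw [pow_one, hGL, Units.val_mul, Units.val_mul, hmat]
  exact hab

/-! ## §2 The socket: a left-level-invariant piece at a level-deep regular split-torus class -/

set_option maxHeartbeats 1600000 in
-- instance-term unification on the CM local carriers (as in ★ p846544)
include hw in
/-- **THE `G`-SIDE OF A LEFT-LEVEL-INVARIANT `K`-CLASS PIECE AT A LEVEL-DEEP REGULAR SPLIT TORUS, SOCKET FORM** (organ «(O2″)-deep SOCKET»).  Setting of ★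
`classOrbitalIntegral_eq_mul_of_level_frame_of_integral_eq` with the frame's matrix reading `(ψ x)_w = T x_w T⁻¹`, `T ∈ GL₃(𝒪_w)`; `g` Borel, `Ad K′`-invariant and
LEFT-INVARIANT under «`u_w ≡ 1 (mod ϖ_v)`» (END fold v6 `hg1` VERBATIM); `t = diag(d)` regular and LEVEL-DEEP (`|d_{i,w} − 1|_w ≤ |ϖ_v|_w`).  If
`∫_N g(ψ⁻¹ n) dμ_N = μ_N(N ∩ K₃) · X` then **`classOrbitalIntegral m_G g ⟦γ₀⟧ = ν_G(K′) · J₃(t) · X`** (`J₃` the ★ FILE D token) — `t`-independent.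
[cite: Rogawski1990, §4.9 pp. 54–56, Prop. 4.9.1; §4.3 (4.3.1) p. 43] [cite: Kottwitz1986, §3] [cite: DeitmarEchterhoff2014, Thm. 1.5.3] -/
theorem classOrbitalIntegral_eq_mul_of_level_frame_of_left_invariant (H' : Matrix (Fin 3) (Fin 3) L)
    (hH : (H'.map (IsCMField.complexConj L))ᵀ = H') (hHd : IsUnit H'.det)
    [MeasurableSpace ((cmDatum L 3 H').Local v)] [BorelSpace ((cmDatum L 3 H').Local v)]
    [∀ γ : (cmDatum L 3 H').Local v, MeasurableSpace (((cmDatum L 3 H').Local v) ⧸ Subgroup.centralizer ({γ} : Set ((cmDatum L 3 H').Local v)))]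
    [∀ γ : (cmDatum L 3 H').Local v, BorelSpace (((cmDatum L 3 H').Local v) ⧸ Subgroup.centralizer ({γ} : Set ((cmDatum L 3 H').Local v)))]
    (νG : Measure ((cmDatum L 3 H').Local v)) [νG.IsHaarMeasure] [νG.IsMulRightInvariant]
    {mG : OrbitalMeasureFamily ((cmDatum L 3 H').Local v)}
    (hmG : mG.IsCanonical (fun γ => IsRegularElt (γ.val : GL (Fin 3) (LocalRing L v))) νG)
    [MeasurableSpace ↥(unitaryGroupOfForm (conjLocal L (IsCMField.complexConj L) v) (cmLocalForm L 3 v))]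
    [BorelSpace ↥(unitaryGroupOfForm (conjLocal L (IsCMField.complexConj L) v) (cmLocalForm L 3 v))]
    (ψ : (cmDatum L 3 H').Local v ≃ₜ* ↥(unitaryGroupOfForm (conjLocal L (IsCMField.complexConj L) v) (cmLocalForm L 3 v)))
    (hψK : ∀ g : (cmDatum L 3 H').Local v, ψ g ∈ cmLocalIntegralLevel L 3 (Matrix.of fun i j : Fin 3 => if i.val + j.val + 1 = 3 then (1 : L) else 0) v ↔
      g ∈ cmLocalIntegralLevel L 3 H' v)
    (hψc : ∀ g : (cmDatum L 3 H').Local v, IsConj (g.val : GL (Fin 3) (LocalRing L v))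
      ((ψ g : ↥(unitaryGroupOfForm (conjLocal L (IsCMField.complexConj L) v) (cmLocalForm L 3 v))) : GL (Fin 3) (LocalRing L v)))
    (T : GL (Fin 3) (w.1.adicCompletion L)) (hT : T ∈ glInt 3 (w.1.adicCompletion L))
    (hψT : ∀ g : (cmDatum L 3 H').Local v, localGLPiEquiv L 3 v
        (((ψ g : ↥(unitaryGroupOfForm (conjLocal L (IsCMField.complexConj L) v) (cmLocalForm L 3 v))) : GL (Fin 3) (LocalRing L v))) w =
      T * localGLPiEquiv L 3 v (g.val : GL (Fin 3) (LocalRing L v)) w * T⁻¹)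
    (μN : Measure ↥(unipotentU (conjLocal L (IsCMField.complexConj L) v) (cmLocalForm L 3 v))) [μN.IsHaarMeasure]
    (t : ↥(torusU (conjLocal L (IsCMField.complexConj L) v) (cmLocalForm L 3 v))) {d : Fin 3 → (LocalRing L v)ˣ}
    (hd : glDiagonal 3 (LocalRing L v) d =
      ((t : ↥(unitaryGroupOfForm (conjLocal L (IsCMField.complexConj L) v) (cmLocalForm L 3 v))) : GL (Fin 3) (LocalRing L v)))
    (hreg : ∀ i j, i ≠ j → IsUnit ((d i : LocalRing L v) - d j))
    (ha' : IsUnit ((((d 0)⁻¹ * d 1 : (LocalRing L v)ˣ) : LocalRing L v) - 1))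
    (hb' : IsUnit ((((d 0)⁻¹ * d 2 : (LocalRing L v)ˣ) : LocalRing L v) - 1))
    (htd : ∀ i : Fin 3, Valued.v ((((d i : (LocalRing L v)ˣ) : LocalRing L v) w) - 1) ≤
      Valued.v (toPlace v w (HeckeCharacter.uniformizer ↥(maximalRealSubfield L) v : v.adicCompletion ↥(maximalRealSubfield L))))
    {γ₀ : (cmDatum L 3 H').Local v} (hγ₀ : ψ γ₀ = (t : ↥(unitaryGroupOfForm (conjLocal L (IsCMField.complexConj L) v) (cmLocalForm L 3 v))))
    (g : (cmDatum L 3 H').Local v → ℂ) (hgm : Measurable g)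
    (hginv : ∀ u ∈ cmLocalIntegralLevel L 3 H' v, ∀ x, g (u * x * u⁻¹) = g x)
    -- left-invariance under the `v`-level-1 congruence set (END fold v6 `stub_levelOneRowsRam` token VERBATIM)
    (hg1 : ∀ u : (cmDatum L 3 H').Local v,
      (∀ a b, Valued.v (((toPlace v w (HeckeCharacter.uniformizer ↥(maximalRealSubfield L) v : v.adicCompletion ↥(maximalRealSubfield L))) ^ 1)⁻¹ *
        ((((localNonsplitEquiv (IsCMField.complexConj L) H' (IsCMField.complexConj_ne_one L) w hw u :
            ↥(unitaryGroupOfForm (galAdicCompletionMap (L := L) (IsCMField.complexConj L) hw) (placeForm H' w.1))) : GL (Fin 3) (w.1.adicCompletion L)) :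
              Matrix (Fin 3) (Fin 3) (w.1.adicCompletion L)) a b - (1 : Matrix (Fin 3) (Fin 3) (w.1.adicCompletion L)) a b)) ≤ 1) →
      ∀ x, g (u * x) = g x)
    (X : ℂ)
    (hX : ∫ n, g (ψ.symm (n : ↥(unitaryGroupOfForm (conjLocal L (IsCMField.complexConj L) v) (cmLocalForm L 3 v)))) ∂μN =
      (μN.real {n : ↥(unipotentU (conjLocal L (IsCMField.complexConj L) v) (cmLocalForm L 3 v)) |
          (n : ↥(unitaryGroupOfForm (conjLocal L (IsCMField.complexConj L) v) (cmLocalForm L 3 v))) ∈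
            cmLocalIntegralLevel L 3 (Matrix.of fun i j : Fin 3 => if i.val + j.val + 1 = 3 then (1 : L) else 0) v} : ℂ) * X) :
    classOrbitalIntegral mG g (ConjClasses.mk γ₀) =
      (νG.real (cmLocalIntegralLevel L 3 H' v : Set ((cmDatum L 3 H').Local v)) : ℂ) *
        (((letI : MeasurableSpace (LocalRing L v) := borel _; haveI : BorelSpace (LocalRing L v) := ⟨rfl⟩
          haveI : SecondCountableTopology (LocalRing L v) := secondCountableTopology_localRing (E := L) v
          ((distribHaarChar (LocalRing L v) ha'.unit)⁻¹ *
            (HeisRing.skewModulus (conjLocal L (IsCMField.complexConj L) v) (continuous_conjLocal L (IsCMField.complexConj L) v) hb'.unit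
              (HeisRing.map_unit_torusCentralScalar_sub_one (conjLocal L (IsCMField.complexConj L) v) (cmLocalForm_eq_over L 3 v) t hd hb'))⁻¹ :
                ℝ≥0)) : ℝ≥0) : ℂ) * X := by
  have hlev := valued_symm_torus_sub_one_le L w hw H' ψ T hT hψT t hd htd
  refine classOrbitalIntegral_eq_mul_of_level_frame_of_integral_eq L H' hH hHd w hw νG hmG ψ hψK hψc μN t hd hreg ha' hb' hγ₀ g hgm hginv
    (fun n => g (ψ.symm (n : ↥(unitaryGroupOfForm (conjLocal L (IsCMField.complexConj L) v) (cmLocalForm L 3 v))))) (fun n => ?_) X hX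
  rw [map_mul]
  exact hg1 _ hlev _

end Literature.NumberTheory.Automorphic.UnitaryGroup

end
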